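import Literature.NumberTheory.FaltingsSerre.ParamodularCited
import Literature.NumberTheory.FaltingsSerre.TypeGCriterion
import Literature.NumberTheory.FaltingsSerre.CoreCertificateTransfer
import Literature.NumberTheory.FaltingsSerre.Paramodular353Core
import Literature.NumberTheory.FaltingsSerre.Paramodular587plusCore
import HarnessLib

/-!
# Cited-form instances `N = 349`, `353`, `587⁺`, and the cited `S₆`-transfer template

[BPPTVY] = A. Brumer, A. Pacetti, C. Poor, G. Tornaría, J. Voight, D. S. Yuen, *On the paramodularity of
typical abelian surfaces*, Algebra & Number Theory **13**:5 (2019) 1145–1195 [cite: BrumerEtAl2019]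
(printed numbering and pages): Thm 7.2.1 p. 1189 (`N = 353`), Thm 7.3.1 p. 1191 (`N = 587`: `A₅₈₇ =
Jac(C₅₈₇)`, LMFDB `587.a.587.1`, with the MINUS form `f₅₈₇⁻`; image `S₆`; the plus pair `(A⁺₅₈₇, f₅₈₇⁺)`
shares the `2`-division field but is NOT treated in print — see `Paramodular587plusCore.lean`),
Lemma 7.1.4 / p. 1188 (Step 1 and the descent to `GSp₄(ℤ₂)` [Lemma 4.3.8(b) p. 1171]), Thm 4.3.4
p. 1169, Prop 4.3.2 p. 1168 (type (G)), (5.1.8) p. 1174, Alg 2.4.1 p. 1155 — and NO statement about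
`N = 349`: [BPPTVY] treats `N = 277, 353, 587` only; the cell applies their method [Alg 2.4.1, Thm 2.1.5,
Thm 4.3.4] to `A₃₄₉ = Jac(C₃₄₉)` (LMFDB `349.a.349.1`) and the Poor–Yuen nonlift `f₃₄₉`
[cite: PoorYuen2015] exactly as `Paramodular349.lean` does.  Paramodularity of `A₃₄₉` and of `A⁺₅₈₇` is
not a published theorem, which is one more reason why every datum below is a binder and only
implications are asserted.

WHAT THIS FILE IS.  Companion of `Paramodular277Cited.lean` (cell record `DIVERGENCE.md` D-29): the
levels `349`, `353` and `587⁺` on the cited-form template `paramodular_of_galoisCertificate_cited`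
(`ParamodularCited.lean`) — NO posited `ρ_f`, `similitude₂`, `residual_conj`, `hρf_unr`, `hρf`; instead the
cited named fact `h438 : BrumerEtAl2019.existsIntegralSymplecticGaloisRep_two_primeLevel`
([Thm 4.3.4 + Lemmas 4.3.6/4.3.8/4.3.10, p. 1188], ARTHUR-DEPENDENT), the curve-side Galois half
`GaloisCertificate N T cyclotomicMultiplier ρA` (D-27), the residual identification datum
`ResidualIdentification N af bf ρA` ([Lemma 7.1.4] content = the certificate's `residual` block read as
a property of `ρ̄_A` and the form's integers — a referee ruling decides whether a given frozen block
attests it as typed), the integer tables, and type (G) DECIDED from the form's `Q₃` by `typeG_of_ineq`: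
* `349`: `Q₃(f₃₄₉) = 1 + T − T² + 3T³ + 9T⁴`, `(a₃, b₃) = (−1, −1)`: `29 ≥ 0`, `1 ≤ 48`, `5 ≥ 0`, `12 ≤ 25`;
* `353`: `Q₃(f₃₅₃) = 1 + 2T + 4T² + 6T³ + 9T⁴`, `(a₃, b₃) = (−2, 4)`: `12 ≥ 0`, `4 ≤ 48`, `10 ≥ 0`, `48 ≤ 100`;
* `587⁺`: `Q₃(f⁺₅₈₇) = 1 + T² + 9T⁴`, `(a₃, b₃) = (0, 1)`: `20 ≥ 0`, `0 ≤ 48`, `7 ≥ 0`, `0 ≤ 49`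
(cell sources: `certs/349/certificate.canonical.json` `form_euler.euler_factor_check_small_p` row `p = 3`
(`implA` ×2 + table line); `certs/353/eng2_form_hecke_353.json` `Q_p.3` (E2b + T);
`certs/587/eng2_form_hecke_587plus.canonical.json` `lambda_p.3.T_p2` (A + C)).
Generic part: `ResidualIdentification.of_conj` (the datum moves along `ρ̄_{A'} = ι(π) ρ̄_A ι(π)⁻¹`) and
`paramodular_of_galoisCertificate_S6_cited` — the D-27 `S₆` transfer with the form side cited: the Galois
half of `A` (image `S₆`, `#im ρ̄_A = 720`), `ker ρ̄_A = ker ρ̄_{A'}`, one good odd `q` with `a_q` even and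
`b_q` odd on both curves [(5.1.8)] PRODUCE `π` in the kernel (`exists_residual_conj_of_eulerData`); then
`GaloisCertificate.ofResidualConj` and the cited template for `(A', f')`.  For `587⁺`: `A = A₅₈₇ = Jac(C⁻₅₈₇)`
(Galois sub-certificate `certs/587/galois`, sha256 `5ba9346a657202460934ea21b5dd12813c66f8395b03112b83a27684d831ddaf`),
`A' = A⁺₅₈₇`, `q = 3`, `L₃(A₅₈₇) = 1 + 4T + 9T² + 12T³ + 9T⁴`, `L₃(A⁺) = 1 + T² + 9T⁴`.
Hashes of the merged certificates whose `residual` / `trace_check` blocks the data binders transcribe: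
`349`: `0b9d070d407f6211ba094695ef509e92c9ce0838fa2e62a6110db86c60cabd92` (Galois half
`97acfd422b1fbc6a0079617fc5247d790f582bdf417ee0064bd40e4f82d52e95`); `353`:
`f9c58454c0fee8091a6b9e1fefbb18ffc9cb091db6d4d5113f028da54859e767` (Galois half
`fbf255d4455154ecaea332c0c7d9b1cbd026cee3b58791f3585ac02ddd097ede`); `587⁺`:
`9ac7f5381b505f82e7e8e9323eccada07156e3105b7cfaeb79e03dd40afb02f1`.
Nothing here supersedes the landed instances (`paramodular_349_holds`, `paramodular_353_holds`,
`paramodular_587plus_holds` and their core / transfer forms); the cited forms have the smaller trust base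
(D-29) once the `residual` ↔ `ResidualIdentification` reading is ruled.
-/

noncomputable section

namespace Literature.NumberTheory.FaltingsSerre

open Polynomial IsDedekindDomain Field Equiv
open Literature.NumberTheory.GaloisRepresentations Literature.NumberTheory.FaltingsSerre.GSp4F2
  Literature.NumberTheory.Automorphic.Paramodular Literature.NumberTheory.Automorphic
  Literature.AlgebraicGeometry.Motives
open scoped NumberField

section Generic

variable {N : ℕ} {T : Finset ℕ} {ν : absoluteGaloisGroup ℚ → ℤ_[2]}
  {ρA ρA' : FramedGaloisRep ℚ ℤ_[2] 4}
  {A A' : AbelianVariety ℚ} {b : Module.Basis (Fin 4) ℚ_[2] (A.rationalTateModule 2)}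
  {b' : Module.Basis (Fin 4) ℚ_[2] (A'.rationalTateModule 2)}
  {f' : Matrix (Fin 2) (Fin 2) ℂ → ℂ}

/-- **Transport of the residual identification datum along a residual conjugacy inside `ι(S₆)`.**
If every admissible `σ̄` is `ι(S₆)`-conjugate to `ρ̄_A` and `ρ̄_{A'} = ι(π) ρ̄_A ι(π)⁻¹`, then every
admissible `σ̄` is `ι(S₆)`-conjugate to `ρ̄_{A'}` (compose with `ι(π)⁻¹ = ι(π⁻¹)`; `ι` is a group
homomorphism). Two surfaces with the same `2`-division Galois module share the datum. [cite: BrumerEtAl2019, §7.3 p. 1191; Lemma 7.1.4 p. 1187] -/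
theorem ResidualIdentification.of_conj {a c : ℕ → ℤ} (h : ResidualIdentification N a c ρA)
    (π : Perm (Fin 6))
    (h₁ : ∀ γ, residual ρA'.toMonoidHom γ =
      iotaGL π * residual ρA.toMonoidHom γ * (iotaGL π)⁻¹) :
    ResidualIdentification N a c ρA' := by
  intro σ hSp hunr hchar hin
  obtain ⟨π', hπ'⟩ := h σ hSp hunr hchar hin
  refine ⟨π' * π⁻¹, fun γ => ?_⟩
  have hA : residual ρA.toMonoidHom γ =
      (iotaGL π)⁻¹ * residual ρA'.toMonoidHom γ * iotaGL π := by
    rw [h₁ γ]; group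
  rw [hπ' γ, hA, map_mul, map_inv, mul_inv_rev, inv_inv]
  group

/-- **The `S₆` transfer with the form side cited** (D-27's `paramodular_of_galoisCertificate_S6` composed
with the cited template).  Inputs about `A` (whose Galois half is certified): `G`, `hcard : #im ρ̄_A = 720`
(image `S₆`), `hframe`; the link `hker : ker ρ̄_A = ker ρ̄_{A'}` (same `2`-division field) and the Euler
factors of `A`, `A'` at one good odd `q` with `a_q` even, `b_q` odd on both sides [(5.1.8)]: the kernel
PRODUCES `π ∈ S₆` with `ρ̄_{A'} = ι(π) ρ̄_A ι(π)⁻¹` (`exists_residual_conj_of_eulerData`) and moves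
Steps 2–4 to `A'` (`GaloisCertificate.ofResidualConj`, using `hs' :` `ρ_{A'}` is `GSp(J)`-valued with
multiplier `χ₂` [(4.1.3)]).  Inputs about `(A', f')`: the cited fact `h438`, the residual identification
datum `hres'` for `ρ̄_{A'}`, the data binders, type (G) `hG'`.  Conclusion `IsParamodularAwayFrom A' N f'`.
[cite: BrumerEtAl2019, Thm 7.3.1 p. 1191; (5.1.8) p. 1174; Alg 2.4.1 p. 1155; Thm 4.3.4 p. 1169; p. 1188] -/
theorem paramodular_of_galoisCertificate_S6_cited [Fact N.Prime] (hN2 : N ≠ 2)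
    (h438 : BrumerEtAl2019.existsIntegralSymplecticGaloisRep_two_primeLevel)
    (G : GaloisCertificate N T ν ρA)
    (hcard : Nat.card (residual ρA.toMonoidHom).range = 720)
    (hframe : A.IsFrameOfTateRep 2 b (rationalize ρA))
    (hker : ∀ γ, residual ρA.toMonoidHom γ = 1 ↔ residual ρA'.toMonoidHom γ = 1)
    (hs' : ∀ σ, IsSimilitude (antiIdAlt4 ℤ_[2]) (cyclotomicMultiplier σ)
      ((ρA' σ : GL (Fin 4) ℤ_[2]) : Matrix (Fin 4) (Fin 4) ℤ_[2]))
    (hframe' : A'.IsFrameOfTateRep 2 b' (rationalize ρA')) {q : ℕ} (hq : q.Prime) (hq2 : q ≠ 2)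
    {a c : ℤ} (hAq : A.HasGoodEulerFactorAt q ((lPolynomialOfSurface q a c).map (Int.castRingHom ℚ)))
    (aA' bA' af' bf' : ℕ → ℤ)
    (hA' : ∀ p : ℕ, p.Prime → ¬ p ∣ N →
      A'.HasGoodEulerFactorAt p ((lPolynomialOfSurface p (aA' p) (bA' p)).map (Int.castRingHom ℚ)))
    (hqN : ¬ q ∣ N) (hq₃ : Even a ∧ Odd c ∧ Even (aA' q) ∧ Odd (bA' q))
    (hres' : ResidualIdentification N af' bf' ρA')
    (hT : ∀ p ∈ T, p.Prime ∧ ¬ p ∣ N ∧ p ≠ 2) (h5' : ∀ p ∈ T, aA' p = af' p)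
    (hcusp' : IsParamodularCuspForm N 2 f') (hne' : ∃ Z ∈ siegelUpperHalfSpace 2, f' Z ≠ 0)
    (hfe' : ∀ p : ℕ, p.Prime → ¬ p ∣ N →
      HasSpinorEulerFactorAt 2 p f' ((lPolynomialOfSurface p (af' p) (bf' p)).map (Int.castRingHom ℂ)))
    (hG' : ∃ p₀ : ℕ, p₀.Prime ∧ ¬ p₀ ∣ N ∧ ∀ z : ℂ,
      ((lPolynomialOfSurface p₀ (af' p₀) (bf' p₀)).map (Int.castRingHom ℂ)).IsRoot z →
        ‖z‖ = (Real.sqrt p₀)⁻¹)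
    (h2' : aA' 2 = af' 2 ∧ bA' 2 = bf' 2) :
    IsParamodularAwayFrom A' N f' := by
  obtain ⟨π, h₁⟩ := exists_residual_conj_of_eulerData
    (GSp4F2.residual_range_eq_iotaGL_of_card ρA ν G.similitude hcard) hs' hker hframe hframe' hq hq2
    hAq (hA' q hq hqN) hq₃.1 hq₃.2.1 hq₃.2.2.1 hq₃.2.2.2
  exact paramodular_of_galoisCertificate_cited hN2 h438 (G.ofResidualConj π h₁ hs') hframe' aA' bA'
    af' bf' hres' hA' hT h5' hcusp' hne' hfe' hG' h2'

end Generic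

/-! ## `N = 349` -/

namespace Paramodular349

/-- **The curve-side Galois half of the `349` certificate, as a hypothesis**:
`GaloisCertificate 349 checkPrimes349 χ₂ ρA` (`similitude` for `J = antiIdAlt4 ℤ_[2]` and multiplier
`cyclotomicMultiplier`, `absIrreducible` (image `S₅(b)`), `complete`) ↔ `certs/349/galois`
(sha256 `97acfd422b1fbc6a0079617fc5247d790f582bdf417ee0064bd40e4f82d52e95`). A `Prop` binder.
[cite: BrumerEtAl2019, Alg 2.4.1 p. 1155; (4.1.3) p. 1163; Lemma 5.1.7 p. 1173] -/
def GaloisCertificate349 (ρA : FramedGaloisRep ℚ ℤ_[2] 4) : Prop :=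
  GaloisCertificate 349 checkPrimes349 cyclotomicMultiplier ρA

/-- Type (G) for `f₃₄₉` at `3`, decided from `Q₃(f₃₄₉) = 1 + T − T² + 3T³ + 9T⁴`, `(a₃, b₃) = (−1, −1)`.
[cite: BrumerEtAl2019, Prop 4.3.2 p. 1168; Thm 4.3.4 p. 1169] -/
theorem typeG_349_at_three (af bf : ℕ → ℤ) (hf3 : af 3 = -1 ∧ bf 3 = -1) :
    ∃ p : ℕ, p.Prime ∧ ¬ p ∣ 349 ∧ ∀ z : ℂ,
      ((lPolynomialOfSurface p (af p) (bf p)).map (Int.castRingHom ℂ)).IsRoot z →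
        ‖z‖ = (Real.sqrt p)⁻¹ :=
  exists_typeG_of_ineq (N := 349) (p₀ := 3) (by norm_num) (by norm_num) af bf
    (by rw [hf3.1, hf3.2]; norm_num) (by rw [hf3.1]; norm_num) (by rw [hf3.2]; norm_num)
    (by rw [hf3.1, hf3.2]; norm_num)

/-- **`A₃₄₉` is paramodular of level `349` away from `349`, with the form side cited** — NOT a
printed theorem: the method of [BPPTVY, Alg 2.4.1 + Thm 2.1.5 + Thm 4.3.4] applied to `(A₃₄₉, f₃₄₉)` as in
`Paramodular349.lean`, conclusion in the shape of [Thm 7.1.3] restricted to `p ≠ 349`, GIVEN the binders.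
`paramodular_of_galoisCertificate_cited` at `N = 349`,
`T = checkPrimes349` (`checkPrimes349_good`).  Binders: `h438` (cited, Arthur-dependent); `G` (Galois
half, sha256 above); `hframe`; `aA bA af bf` with `hA`, `hfe`; `hres` the residual identification datum
(merged certificate `residual` block, sha256 `0b9d070d…`); `h5` the trace table; `hcusp`, `hne`;
`hf3 : (a₃, b₃)(f) = (−1, −1)`; `h2` (`L₂ = Q₂ = 1 + 2T + 2T² + 4T³ + 4T⁴`).
[cite: BrumerEtAl2019, Thm 7.1.3 p. 1187 (shape of the statement only); Lemma 7.1.4 p. 1187; p. 1188; Thm 4.3.4 p. 1169; Alg 2.4.1 p. 1155] -/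
theorem paramodular_349_cited
    {A : AbelianVariety ℚ} {f : Matrix (Fin 2) (Fin 2) ℂ → ℂ} {ρA : FramedGaloisRep ℚ ℤ_[2] 4}
    {b : Module.Basis (Fin 4) ℚ_[2] (A.rationalTateModule 2)}
    (h438 : BrumerEtAl2019.existsIntegralSymplecticGaloisRep_two_primeLevel)
    (G : GaloisCertificate349 ρA)
    (hframe : A.IsFrameOfTateRep 2 b (rationalize ρA)) (aA bA af bf : ℕ → ℤ)
    (hres : ResidualIdentification 349 af bf ρA)
    (hA : ∀ p : ℕ, p.Prime → ¬ p ∣ 349 →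
      A.HasGoodEulerFactorAt p ((lPolynomialOfSurface p (aA p) (bA p)).map (Int.castRingHom ℚ)))
    (h5 : ∀ p ∈ checkPrimes349, aA p = af p)
    (hcusp : IsParamodularCuspForm 349 2 f) (hne : ∃ Z ∈ siegelUpperHalfSpace 2, f Z ≠ 0)
    (hfe : ∀ p : ℕ, p.Prime → ¬ p ∣ 349 →
      HasSpinorEulerFactorAt 2 p f ((lPolynomialOfSurface p (af p) (bf p)).map (Int.castRingHom ℂ)))
    (hf3 : af 3 = -1 ∧ bf 3 = -1) (h2 : aA 2 = af 2 ∧ bA 2 = bf 2) :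
    IsParamodularAwayFrom A 349 f :=
  haveI : Fact (Nat.Prime 349) := ⟨by norm_num⟩
  paramodular_of_galoisCertificate_cited (by norm_num) h438 G hframe aA bA af bf hres hA
    checkPrimes349_good h5 hcusp hne hfe (typeG_349_at_three af bf hf3) h2

end Paramodular349

/-! ## `N = 353` -/

namespace Paramodular353

/-- **The curve-side Galois half of the `353` certificate, as a hypothesis**:
`GaloisCertificate 353 checkPrimes353 χ₂ ρA` (image `S₃ ≀ S₂`; `similitude`, `absIrreducible`, `complete`)
↔ `certs/353/galois` (sha256 `fbf255d4455154ecaea332c0c7d9b1cbd026cee3b58791f3585ac02ddd097ede`).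
A `Prop` binder. [cite: BrumerEtAl2019, Alg 2.4.1 p. 1155; (4.1.3) p. 1163; Thm 7.2.1 p. 1189] -/
def GaloisCertificate353 (ρA : FramedGaloisRep ℚ ℤ_[2] 4) : Prop :=
  GaloisCertificate 353 checkPrimes353 cyclotomicMultiplier ρA

/-- Type (G) for `f₃₅₃` at `3`, decided from `Q₃(f₃₅₃) = 1 + 2T + 4T² + 6T³ + 9T⁴`, `(a₃, b₃) = (−2, 4)`.
[cite: BrumerEtAl2019, Prop 4.3.2 p. 1168; Thm 4.3.4 p. 1169] -/
theorem typeG_353_at_three (af bf : ℕ → ℤ) (hf3 : af 3 = -2 ∧ bf 3 = 4) :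
    ∃ p : ℕ, p.Prime ∧ ¬ p ∣ 353 ∧ ∀ z : ℂ,
      ((lPolynomialOfSurface p (af p) (bf p)).map (Int.castRingHom ℂ)).IsRoot z →
        ‖z‖ = (Real.sqrt p)⁻¹ :=
  exists_typeG_of_ineq (N := 353) (p₀ := 3) (by norm_num) (by norm_num) af bf
    (by rw [hf3.1, hf3.2]; norm_num) (by rw [hf3.1]; norm_num) (by rw [hf3.2]; norm_num)
    (by rw [hf3.1, hf3.2]; norm_num)

/-- **`A₃₅₃` is paramodular of level `353` away from `353`, with the form side cited**
([BPPTVY, Thm 7.2.1] restricted to `p ≠ 353`).  `paramodular_of_galoisCertificate_cited` at `N = 353`,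
`T = checkPrimes353` (`checkPrimes353_good`).  Binders as for `349`; `hf3 : (a₃, b₃)(f) = (−2, 4)`;
`h2` (`L₂ = Q₂ = 1 + T + 3T² + 2T³ + 4T⁴`).  `hres : ResidualIdentification 353 af bf ρA` ↔ the `residual`
block of the merged certificate (sha256 `f9c58454…`; image `S₃ ≀ S₂`, route `ofRangeS3wrS2`) — Step 1 as
PRINTED in the proof of [Thm 7.2.1, pp. 1189–1190] (NOT Lemma 7.1.4, which is the `277`/`S₅(b)` argument):
`ρ̄_A` has image `S₃ ≀ C₂` (2-torsion field = splitting field of `x⁶ + 2x⁴ + 2x³ + 5x² + 2x + 1`); for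
`G = Gal(K|ℚ)`, `K` the fixed field of `ker ρ̄_f`, the charpolys at two good primes give elements of order
`3` or `6` with both traces, hence cycle types `3¹` and `3²` (printed with "`L₃(A,T) ≡ 1 + T + T³ + T⁴`",
a misprint for `L₅`: `L₃(A₃₅₃) = 1 + 2T + 4T² + 6T³ + 9T⁴ ≡ 1 + T⁴` while
`L₅ = 1 − T + 2T² − 5T³ + 25T⁴ ≡ 1 + T + T³ + T⁴`, (7.2.2); the cell's exclusion primes are
`P_res = [5, 11, 13]`), hence `G ∈ {C₃², C₃:S₃, C₃×S₃ (twice), C₃:S₃·C₂, S₃² (twice), S₃≀C₂, A₆, S₆}`;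
the groups with a `C₃`- or `S₃`-quotient are killed by Kronecker–Weber (`353 ≡ 2 mod 3`: no `C₃`-extension
unramified outside `{2, 353}`) and by the class-field facts "the unique `S₃` extension ramified only at
`2, 353` is `x³ − x² − 6x + 14`" and "it has no cyclic cubic extension unramified away from `2, 353`"
[p. 1190] (the cell's RESID-2 class-field fold, ×2); for the transitive `C₃:S₃·C₂, S₃≀C₂, A₆, S₆`,
Prop 5.2.4 [p. 1175] (for `C₃:S₃·C₂`: `ord₃₅₃ d_{K′} ∈ {0, 1, 3}`, `3` excluded by the absence of a `2³`
element) gives `ord₃₅₃ d_{K′} ≤ 1`, and [JonesRoberts2014] lists exactly two sextic candidates (CITED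
database), `x⁶ − 2x⁵ + 2x⁴ − x² + 1` and `x⁶ − 2x⁵ − 3x⁴ + 4x³ + x² − 6x + 1`; one is excluded by a
Frobenius of order `6` at `3` against `Q₃(f) ≡ 1 + T⁴` and the other is `ℚ(A[2])`, `G ≅ S₃ ≀ C₂` (as
printed, "in the first extension `Frob₃` has order 6 … so we have the latter"; in fact the `6`-cycle at `3`
is in the SECOND polynomial's field and the FIRST, LMFDB `6.0.22592.1`, is `ℚ(A₃₅₃[2])` — the conclusion
is unaffected); finally a Frobenius trace fixes which of the two embeddings `S₃ ≀ C₂ ↪ GSp₄(𝔽₂)` occurs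
(printed with `Frob₃`, which has type `(4,2)` and trace `0` under both embeddings; the cell uses `Frob₅`,
order `3`, trace `1`).  The three print slips are the cell's PRINT-ERRATA E3–E5 (referee Audit 39), all
harmless to the published conclusion.  Kernel counterparts: the exclusions at `P_res` are re-decided in
`KernelResidualExclusion353.lean`, the embedding rigidity is `ResidualRigidityS3wrS2.lean`, and
`Paramodular353CitedOfCard.lean` derives `hres` from a kernel identification.  All inputs are of the
(a1)–(a4) type of `ResidualIdentification` (charpolys at `3, 5, 11` with the form's integers; unramified
outside `{2, 353}`; inertia bound [Lemma 4.3.10 p. 1172]).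
[cite: BrumerEtAl2019, Thm 7.2.1 pp. 1189–1190; (7.2.2) p. 1189; Prop 5.2.4 p. 1175; p. 1188; Thm 4.3.4 p. 1169; Alg 2.4.1 p. 1155] [cite: JonesRoberts2014] -/
theorem paramodular_353_cited
    {A : AbelianVariety ℚ} {f : Matrix (Fin 2) (Fin 2) ℂ → ℂ} {ρA : FramedGaloisRep ℚ ℤ_[2] 4}
    {b : Module.Basis (Fin 4) ℚ_[2] (A.rationalTateModule 2)}
    (h438 : BrumerEtAl2019.existsIntegralSymplecticGaloisRep_two_primeLevel)
    (G : GaloisCertificate353 ρA)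
    (hframe : A.IsFrameOfTateRep 2 b (rationalize ρA)) (aA bA af bf : ℕ → ℤ)
    (hres : ResidualIdentification 353 af bf ρA)
    (hA : ∀ p : ℕ, p.Prime → ¬ p ∣ 353 →
      A.HasGoodEulerFactorAt p ((lPolynomialOfSurface p (aA p) (bA p)).map (Int.castRingHom ℚ)))
    (h5 : ∀ p ∈ checkPrimes353, aA p = af p)
    (hcusp : IsParamodularCuspForm 353 2 f) (hne : ∃ Z ∈ siegelUpperHalfSpace 2, f Z ≠ 0)
    (hfe : ∀ p : ℕ, p.Prime → ¬ p ∣ 353 →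
      HasSpinorEulerFactorAt 2 p f ((lPolynomialOfSurface p (af p) (bf p)).map (Int.castRingHom ℂ)))
    (hf3 : af 3 = -2 ∧ bf 3 = 4) (h2 : aA 2 = af 2 ∧ bA 2 = bf 2) :
    IsParamodularAwayFrom A 353 f :=
  haveI : Fact (Nat.Prime 353) := ⟨by norm_num⟩
  paramodular_of_galoisCertificate_cited (by norm_num) h438 G hframe aA bA af bf hres hA
    checkPrimes353_good h5 hcusp hne hfe (typeG_353_at_three af bf hf3) h2

end Paramodular353

/-! ## `N = 587`, the plus pair, by `S₆` transfer from the Galois half of `A₅₈₇` -/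

namespace Paramodular587plus

/-- Type (G) for `f⁺₅₈₇` at `3`, decided from `Q₃(f⁺₅₈₇) = 1 + T² + 9T⁴`, `(a₃, b₃) = (0, 1)`.
[cite: BrumerEtAl2019, Prop 4.3.2 p. 1168; Thm 4.3.4 p. 1169] -/
theorem typeG_587plus_at_three (af bf : ℕ → ℤ) (hf3 : af 3 = 0 ∧ bf 3 = 1) :
    ∃ p : ℕ, p.Prime ∧ ¬ p ∣ 587 ∧ ∀ z : ℂ,
      ((lPolynomialOfSurface p (af p) (bf p)).map (Int.castRingHom ℂ)).IsRoot z →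
        ‖z‖ = (Real.sqrt p)⁻¹ :=
  exists_typeG_of_ineq (N := 587) (p₀ := 3) (by norm_num) (by norm_num) af bf
    (by rw [hf3.1, hf3.2]; norm_num) (by rw [hf3.1]; norm_num) (by rw [hf3.2]; norm_num)
    (by rw [hf3.1, hf3.2]; norm_num)

/-- **`A⁺₅₈₇` is paramodular of level `587` away from `587`, with the form side cited, by transfer of
the Galois half of `A₅₈₇`** — the plus pair, NOT treated in print ([BPPTVY, Thm 7.3.1] is the minus pair
`(A₅₈₇, f₅₈₇⁻)`); method [Alg 2.4.1] with the `S₆` transfer [(5.1.8)], conclusion in the shape of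
[Thm 7.3.1] restricted to `p ≠ 587`, GIVEN the binders.
`paramodular_of_galoisCertificate_S6_cited` at `N = 587`, `T = checkPrimes587plus`, `q = 3`.  Binders
about `A₀ = A₅₈₇`: `hG : GaloisCertificate587 ν₀ ρ₀` (sha256 `5ba9346a…`), `hcard : #im ρ̄₀ = 720`,
`hframe₀`, `hA₃ : L₃(A₅₈₇) = L(3, a₃, b₃)` with `h₃ : a₃` even, `b₃` odd (certified `(−4, 9)`); the link
`hker : ker ρ̄₀ = ker ρ̄_A` (`certs/587/galois_plus`, sha256 `6872150b…`); about `(A⁺, f⁺)`: `hs` (`ρ_A`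
is `GSp(J)`-valued with multiplier `χ₂`, [(4.1.3)]), `hframe`, data `aA bA af bf` with `hA`, `hfe`,
`h₃' : aA 3` even, `bA 3` odd (certified `(0, 1)`), `hres` (residual identification for `ρ̄_{A⁺}` ↔ the
plus certificate's `residual` block, sha256 `9ac7f538…`), `h5`, `hcusp`, `hne`, `hf3 : (a₃, b₃)(f⁺) = (0, 1)`,
`h2`.  No `ρ_f`, no pair datum. [cite: BrumerEtAl2019, Thm 7.3.1 p. 1191 (minus pair; shape of the statement); (5.1.8) p. 1174; Alg 2.4.1 p. 1155; Thm 4.3.4 p. 1169; p. 1188] -/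
theorem paramodular_587plus_cited
    {ν₀ : absoluteGaloisGroup ℚ → ℤ_[2]} {ρ₀ ρA : FramedGaloisRep ℚ ℤ_[2] 4}
    {A₀ A : AbelianVariety ℚ} {b₀ : Module.Basis (Fin 4) ℚ_[2] (A₀.rationalTateModule 2)}
    {b : Module.Basis (Fin 4) ℚ_[2] (A.rationalTateModule 2)} {f : Matrix (Fin 2) (Fin 2) ℂ → ℂ}
    (h438 : BrumerEtAl2019.existsIntegralSymplecticGaloisRep_two_primeLevel)
    (hG : GaloisCertificate587 ν₀ ρ₀)
    (hcard : Nat.card (residual ρ₀.toMonoidHom).range = 720)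
    (hframe₀ : A₀.IsFrameOfTateRep 2 b₀ (rationalize ρ₀)) {a₃ b₃ : ℤ}
    (hA₃ : A₀.HasGoodEulerFactorAt 3 ((lPolynomialOfSurface 3 a₃ b₃).map (Int.castRingHom ℚ)))
    (h₃ : Even a₃ ∧ Odd b₃)
    (hker : ∀ γ, residual ρ₀.toMonoidHom γ = 1 ↔ residual ρA.toMonoidHom γ = 1)
    (hs : ∀ σ, IsSimilitude (antiIdAlt4 ℤ_[2]) (cyclotomicMultiplier σ)
      ((ρA σ : GL (Fin 4) ℤ_[2]) : Matrix (Fin 4) (Fin 4) ℤ_[2]))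
    (hframe : A.IsFrameOfTateRep 2 b (rationalize ρA)) (aA bA af bf : ℕ → ℤ)
    (hA : ∀ p : ℕ, p.Prime → ¬ p ∣ 587 →
      A.HasGoodEulerFactorAt p ((lPolynomialOfSurface p (aA p) (bA p)).map (Int.castRingHom ℚ)))
    (h₃' : Even (aA 3) ∧ Odd (bA 3))
    (hres : ResidualIdentification 587 af bf ρA)
    (h5 : ∀ p ∈ checkPrimes587plus, aA p = af p)
    (hcusp : IsParamodularCuspForm 587 2 f) (hne : ∃ Z ∈ siegelUpperHalfSpace 2, f Z ≠ 0)
    (hfe : ∀ p : ℕ, p.Prime → ¬ p ∣ 587 →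
      HasSpinorEulerFactorAt 2 p f ((lPolynomialOfSurface p (af p) (bf p)).map (Int.castRingHom ℂ)))
    (hf3 : af 3 = 0 ∧ bf 3 = 1) (h2 : aA 2 = af 2 ∧ bA 2 = bf 2) :
    IsParamodularAwayFrom A 587 f :=
  haveI : Fact (Nat.Prime 587) := ⟨by norm_num⟩
  paramodular_of_galoisCertificate_S6_cited (by norm_num) h438 hG hcard hframe₀ hker hs hframe
    (by norm_num) (by norm_num) hA₃ aA bA af bf hA (by norm_num) ⟨h₃.1, h₃.2, h₃'.1, h₃'.2⟩ hres
    checkPrimes587plus_good h5 hcusp hne hfe (typeG_587plus_at_three af bf hf3) h2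

end Paramodular587plus

end Literature.NumberTheory.FaltingsSerre

end
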